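import Summits.CriticalPhenomena.CardyFormulaZ2.Theses.CardyPolygonWords
import Literature.Probability.LatticeModels.PercolationPolygonWord
import Literature.Probability.RandomPlanarGeometry.RectangleModulusAspectRatio
import Literature.Probability.RandomPlanarGeometry.ConformalRectangleProofs
import Summits.CriticalPhenomena.CardyFormulaZ2.Theorems.RectilinearCardy.Negative.RectilinearCardySquareInstance

/-!
# Birth skeleton (BC3) for crux `CardyOneStep` (stmt-CriticalPhenomena-4783)

Route `CardyPolygonWords` (route-CriticalPhenomena-CardyPolygonWords), sub-problem `CardyFormulaZ2`,
crux (rank 3)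

  `CardyOneStep` — Cardy's formula (G02 discretisation `bondDomainCrossingProb`, bond-`ℤ²`, `p = 1/2`)
  for every ONE-STEP polygon `(0,a)×(0,b) ∪ (c,d)×(b,b+e) ∪ seam` with the two bottom and the two
  top corners marked: the words `⟨β| T_{n'}^{m'} J T_n^{m} |α⟩` with exactly one junction letter.

## The line (the route's reading of the crux, typed at probability level over the landed word
vocabulary `Literature.Probability.LatticeModels.polygonWordAmplitude`; four stubs)

The crux docstring: "given `CardyRectangle`, it says that the scaling limits of the junction overlaps
between the boundary-state-visible scaling states EXIST and EQUAL the Schwarz–Christoffel step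
vertex". Its probability-level shadow is the conjunction of

* `stub_rectangleData` — the route's rank-2 input `CardyRectangle` (stmt-CriticalPhenomena-4782, BY
  NAME; words of length one). OPEN (Schramm ICM 2006 Prob. 2.11 cut to rectangles).
* `stub_oneStepWordExactness` — the DICTIONARY letter of this crux: for a one-step polygon with real
  side lengths and EVERY mesh `δ > 0`, the G02 crossing probability IS the transfer-matrix word
  amplitude, `bondDomainCrossingProb R δ = polygonWordAmplitude R δ`. Provable now (M): the tree's
  `RowTransferExactness_holds` / `PolygonWord.discreteCrossingProb_polyomino_eq` cover polyominoes at
  ALIGNED meshes; the one-step carrier needs the same two inputs at every mesh — boundedness and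
  "every `ℤ²`-edge between two mesh vertices has its closed segment in `Ω̄`" (both rectangles and the
  seam are convex and a vertical edge crossing height `b` passes through the closed seam), after
  which `PolygonWord.bondPercolation_real_crossing_eq_latticeWordAmplitude` applies verbatim.
* `stub_oneStepWordLimit` — EXISTENCE of the scaling limit of the one-junction word amplitudes
  (shadow of the informal item JunctionOverlapLimit, stmt-5237: spectral convergence of the two strip
  transfer matrices in the boundary-visible sectors + ℓ¹-summable junction overlaps). OPEN (XL).
* `stub_oneStepModulusLaw` — the limit, whenever it exists, is a function of the conformal modulus
  `η = crossRatio x` ALONE, one function `G` for the whole one-step family incl. its degenerate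
  members, the rectangles (shadow of StepMapVertex, stmt-5275: the junction overlaps are the matrix
  elements of the Schwarz–Christoffel step map, which is exactly what makes the sewn amplitude depend
  on `η` only). OPEN (XL); this is where `EmbeddingModulusUniqueness` bites (the word is shear-blind),
  evaded only through the non-blind input `stub_rectangleData` as the route's BARRIERS section says.

ASSEMBLY `CardyOneStep_of` (real proof, tree theorems only): for a one-step `R` with datum `(φ, x)`,
`η = crossRatio x ∈ (0,1)` (`crossRatio_mem_Ioo_of_isUniformizing`) is realised by a corner-marked
rectangle `R₀ = (0,w)×(0,h)` with a datum `(φ₀, x₀)` (`rectangle_crossRatio_eq_of_aspectRatio_holds`,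
`exists_brRect`, `exists_isUniformizing_holds` — all PROVED); `R₀` is ALSO a one-step polygon
(`a = d = w`, `c = 0`, `b = e = h/2`: a set identity), so by exactness + `CardyRectangle` its word
amplitude tends to `cardyFunction η`, while by the two limit stubs it tends to `G η`; limits along
the proper filter `𝓝[>] 0` are unique, so `G η = cardyFunction η`; the two limit stubs on `R` and
exactness on `R` then give `bondDomainCrossingProb R δ → cardyFunction (crossRatio x)`.

No new definitions (four reducible `Registered.stub_*` aliases key the stub statements by name for
the skeleton audit); sorries ONLY inside the four `stub_*`.
-/

open Filter Topology Set
open UpperHalfPlane (upperHalfPlaneSet)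
open Literature.Probability.RandomPlanarGeometry
open Literature.Probability.Percolation (bondDomainCrossingProb)
open Literature.Probability.LatticeModels (polygonWordAmplitude)
open Summit.CriticalPhenomena.CardyFormulaZ2.Theses.CardyPolygonWords (CardyRectangle CardyOneStep)

namespace Summit.CriticalPhenomena.CardyFormulaZ2.Cruxes.CardyOneStep.Birth

/-! ## Stubs -/

/-- **Stub 1 (OPEN — the route's rank-2 input, stmt-CriticalPhenomena-4782, BY NAME)** — Cardy's
formula in the G02 discretisation for every corner-marked rectangle `(0,a)×(0,b)` of bond-`ℤ²` at
`p = 1/2` (the words of length one `⟨β|T_n^m|α⟩`). Why it might fail: it IS conformal invariance for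
one shape family (Schramm ICM 2006, Problem 2.11); false iff bond-`ℤ²` crossing universality fails. -/
theorem stub_rectangleData : CardyRectangle := by
  sorry

/-- **Stub 2 (the dictionary; M, provable now)** — for a one-step polygon with real side lengths and
EVERY mesh `δ > 0` the G02 crossing probability of bond-`ℤ²` at `p = 1/2` equals the transfer-matrix
word amplitude of `Literature.Probability.LatticeModels.polygonWordAmplitude` (same discrete domain,
same discrete arcs; the only input is that the G02 graph of a one-step carrier is the subgraph of
`ℤ²` induced on `meshDomain`, cf. `PolygonWord.discreteCrossingProb_polyomino_eq` for polyominoes at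
aligned meshes). The marks play no role. Why it might fail: only through a discretisation convention
(it does not: both sides read the same `meshDomainFinset` and `discreteArc`s). -/
theorem stub_oneStepWordExactness :
    ∀ (R : ConformalRectangle) (a b c d e : ℝ), 0 < b → 0 < e → max 0 c < min a d →
      R.carrier = {z : ℂ | (0 < z.re ∧ z.re < a ∧ 0 < z.im ∧ z.im < b) ∨
        (c < z.re ∧ z.re < d ∧ b < z.im ∧ z.im < b + e) ∨
        (max 0 c < z.re ∧ z.re < min a d ∧ z.im = b)} →
      ∀ δ : ℝ, 0 < δ → bondDomainCrossingProb R δ = polygonWordAmplitude R δ := by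
  sorry

/-- **Stub 3 (OPEN, XL — existence of the one-junction word limit; shadow of JunctionOverlapLimit,
stmt-5237)** — for every corner-marked one-step polygon the word amplitudes
`⟨β| T_{n'}^{m'} J T_n^{m} |α⟩` converge as the mesh `δ → 0⁺`. Why it might fail: the junction
overlaps between the scaling states of the two strips may fail to converge summably (c = 0 Jordan
cells entering at the `3π/2` corners, arXiv:1303.3633). -/
theorem stub_oneStepWordLimit :
    ∀ (R : ConformalRectangle) (a b c d e : ℝ), 0 < b → 0 < e → max 0 c < min a d →
      R.carrier = {z : ℂ | (0 < z.re ∧ z.re < a ∧ 0 < z.im ∧ z.im < b) ∨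
        (c < z.re ∧ z.re < d ∧ b < z.im ∧ z.im < b + e) ∨
        (max 0 c < z.re ∧ z.re < min a d ∧ z.im = b)} →
      Set.range R.pt = {(0 : ℂ), (a : ℂ), (d : ℂ) + ((b + e : ℝ) : ℂ) * Complex.I,
        (c : ℂ) + ((b + e : ℝ) : ℂ) * Complex.I} →
      ∃ L : ℝ, Tendsto (polygonWordAmplitude R) (𝓝[>] 0) (𝓝 L) := by
  sorry

/-- **Stub 4 (OPEN, XL — the modulus law; shadow of StepMapVertex, stmt-5275)** — ONE function `G`
of the conformal modulus governs the whole one-step family (rectangles included as the degenerate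
members `c = 0`, `d = a`): whenever the word amplitudes of a corner-marked one-step polygon converge,
the limit is `G (crossRatio x)` for every uniformizing datum `(φ, x)`. This is conformal invariance
INSIDE the one-step family without the value; the route obtains it from the identification of the
junction overlaps with the matrix elements of the Schwarz–Christoffel step map. Why it might fail:
the lattice width change may keep an `O(1)` excess length different from the conformal excess
modulus of the step (then limits exist but are not functions of `η`); `EmbeddingModulusUniqueness`:
no shear-blind argument proves it. -/
theorem stub_oneStepModulusLaw :
    ∃ G : ℝ → ℝ, ∀ (R : ConformalRectangle) (a b c d e : ℝ), 0 < b → 0 < e → max 0 c < min a d →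
      R.carrier = {z : ℂ | (0 < z.re ∧ z.re < a ∧ 0 < z.im ∧ z.im < b) ∨
        (c < z.re ∧ z.re < d ∧ b < z.im ∧ z.im < b + e) ∨
        (max 0 c < z.re ∧ z.re < min a d ∧ z.im = b)} →
      Set.range R.pt = {(0 : ℂ), (a : ℂ), (d : ℂ) + ((b + e : ℝ) : ℂ) * Complex.I,
        (c : ℂ) + ((b + e : ℝ) : ℂ) * Complex.I} →
      ∀ (φ : ConformalEquiv upperHalfPlaneSet R.carrier) (x : Fin 4 → ℝ), R.IsUniformizing φ x →
        ∀ L : ℝ, Tendsto (polygonWordAmplitude R) (𝓝[>] 0) (𝓝 L) → L = G (crossRatio x) := by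
  sorry

/-! ## Assembly glue (tree theorems only, no sorry) -/

/-- Every `η ∈ (0,1)` is the cross-ratio of a uniformizing datum of some corner-marked axis-parallel
rectangle (the rectangle modulus is onto `(0,1)` — `rectangle_crossRatio_eq_of_aspectRatio_holds` —,
corner-marked rectangles exist — `exists_brRect` —, uniformizing data exist —
`exists_isUniformizing_holds`; all proved in the tree). [folklore] -/
theorem exists_rect_datum_of_mem_Ioo {η : ℝ} (hη : η ∈ Ioo (0:ℝ) 1) :
    ∃ (R : ConformalRectangle) (w h : ℝ) (φ : ConformalEquiv upperHalfPlaneSet R.carrier)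
      (x : Fin 4 → ℝ), 0 < w ∧ 0 < h ∧ R.carrier = Ioo (0:ℝ) w ×ℂ Ioo (0:ℝ) h ∧
      (R.pt 0 = (h:ℂ) * Complex.I ∧ R.pt 1 = 0 ∧ R.pt 2 = (w:ℂ) ∧ R.pt 3 = (w:ℂ) + (h:ℂ) * Complex.I) ∧
      R.IsUniformizing φ x ∧ crossRatio x = η := by
  obtain ⟨g, -, himg, hall⟩ := rectangle_crossRatio_eq_of_aspectRatio_holds
  have hη' : η ∈ g '' Ioi 0 := by rw [himg]; exact hη
  obtain ⟨r, hr, hgr⟩ := hη'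
  obtain ⟨R, hcar, hpt⟩ :=
    Summit.CriticalPhenomena.CardyFormulaZ2.Theorems.RectilinearCardy.Negative.exists_brRect r 1 hr
      one_pos
  obtain ⟨φ, x, hφx⟩ := MarkedDomain.exists_isUniformizing_holds R
  refine ⟨R, r, 1, φ, x, hr, one_pos, hcar, hpt, hφx, ?_⟩
  rw [hall R r 1 hr one_pos hcar hpt φ x hφx, div_one, hgr]

/-- A corner-marked rectangle `(0,w)×(0,h)` in Bollobás–Riordan position, read as an instance of the
hypotheses of `CardyRectangle`: the carrier as a set-builder box. [folklore] -/
theorem rect_carrier_setOf {R : ConformalRectangle} {w h : ℝ}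
    (hcar : R.carrier = Ioo (0:ℝ) w ×ℂ Ioo (0:ℝ) h) :
    R.carrier = {z : ℂ | 0 < z.re ∧ z.re < w ∧ 0 < z.im ∧ z.im < h} := by
  rw [hcar]
  ext z
  simp only [Complex.mem_reProdIm, mem_Ioo, mem_setOf_eq, and_assoc]

/-- … and its four marks as the set `{0, w, w + ih, ih}`. [folklore] -/
theorem rect_range_pt {R : ConformalRectangle} {w h : ℝ}
    (hpt : R.pt 0 = (h:ℂ) * Complex.I ∧ R.pt 1 = 0 ∧ R.pt 2 = (w:ℂ) ∧ R.pt 3 = (w:ℂ) + (h:ℂ) * Complex.I) :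
    Set.range R.pt = {(0 : ℂ), (w : ℂ), (w : ℂ) + (h : ℂ) * Complex.I, (h : ℂ) * Complex.I} := by
  obtain ⟨h0, h1, h2, h3⟩ := hpt
  ext z
  simp only [mem_range, mem_insert_iff, mem_singleton_iff]
  constructor
  · rintro ⟨i, rfl⟩
    fin_cases i
    · exact Or.inr (Or.inr (Or.inr h0))
    · exact Or.inl h1
    · exact Or.inr (Or.inl h2)
    · exact Or.inr (Or.inr (Or.inl h3))
  · rintro (rfl | rfl | rfl | rfl)
    exacts [⟨1, h1⟩, ⟨2, h2⟩, ⟨3, h3⟩, ⟨0, h0⟩]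

/-- A corner-marked rectangle `(0,w)×(0,h)` IS a (degenerate) one-step polygon: `a = d = w`, `c = 0`,
`b = e = h/2` — the carrier identity. [folklore] -/
theorem rect_carrier_oneStep {R : ConformalRectangle} {w h : ℝ} (hh : 0 < h)
    (hcar : R.carrier = Ioo (0:ℝ) w ×ℂ Ioo (0:ℝ) h) :
    R.carrier = {z : ℂ | (0 < z.re ∧ z.re < w ∧ 0 < z.im ∧ z.im < h / 2) ∨
      (0 < z.re ∧ z.re < w ∧ h / 2 < z.im ∧ z.im < h / 2 + h / 2) ∨
      (max 0 0 < z.re ∧ z.re < min w w ∧ z.im = h / 2)} := by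
  rw [rect_carrier_setOf hcar]
  ext z
  simp only [mem_setOf_eq, max_self, min_self, add_halves]
  constructor
  · rintro ⟨h1, h2, h3, h4⟩
    rcases lt_trichotomy z.im (h / 2) with hlt | heq | hgt
    · exact Or.inl ⟨h1, h2, h3, hlt⟩
    · exact Or.inr (Or.inr ⟨h1, h2, heq⟩)
    · exact Or.inr (Or.inl ⟨h1, h2, hgt, h4⟩)
  · rintro (⟨h1, h2, h3, h4⟩ | ⟨h1, h2, h3, h4⟩ | ⟨h1, h2, h3⟩)
    · exact ⟨h1, h2, h3, by linarith⟩
    · exact ⟨h1, h2, by linarith, h4⟩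
    · exact ⟨h1, h2, by rw [h3]; linarith, by rw [h3]; linarith⟩

/-- … and the marks identity of the same degenerate one-step polygon. [folklore] -/
theorem rect_range_pt_oneStep {R : ConformalRectangle} {w h : ℝ}
    (hpt : R.pt 0 = (h:ℂ) * Complex.I ∧ R.pt 1 = 0 ∧ R.pt 2 = (w:ℂ) ∧ R.pt 3 = (w:ℂ) + (h:ℂ) * Complex.I) :
    Set.range R.pt = {(0 : ℂ), (w : ℂ), (w : ℂ) + ((h / 2 + h / 2 : ℝ) : ℂ) * Complex.I,
      ((0 : ℝ) : ℂ) + ((h / 2 + h / 2 : ℝ) : ℂ) * Complex.I} := by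
  rw [rect_range_pt hpt, add_halves, Complex.ofReal_zero, zero_add]

/-! ## Name-keyed aliases of the four stub statements (the hypotheses of the composition)

The skeleton audit (`#h21_check_skeleton`, HarnessLib/Audit/Check.lean) admits as hypotheses of the
composition exactly the registered obligations and the declared stubs BY NAME; these reducible aliases
key each stub statement by its stub name. -/
namespace Registered

/-- Alias of the statement of `stub_rectangleData` (= the route item `CardyRectangle`). -/
abbrev stub_rectangleData : Prop := CardyRectangle

/-- Alias of the statement of `stub_oneStepWordExactness`, keyed by the stub name. -/
abbrev stub_oneStepWordExactness : Prop :=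
  ∀ (R : ConformalRectangle) (a b c d e : ℝ), 0 < b → 0 < e → max 0 c < min a d →
    R.carrier = {z : ℂ | (0 < z.re ∧ z.re < a ∧ 0 < z.im ∧ z.im < b) ∨
      (c < z.re ∧ z.re < d ∧ b < z.im ∧ z.im < b + e) ∨
      (max 0 c < z.re ∧ z.re < min a d ∧ z.im = b)} →
    ∀ δ : ℝ, 0 < δ → bondDomainCrossingProb R δ = polygonWordAmplitude R δ

/-- Alias of the statement of `stub_oneStepWordLimit`, keyed by the stub name. -/
abbrev stub_oneStepWordLimit : Prop :=
  ∀ (R : ConformalRectangle) (a b c d e : ℝ), 0 < b → 0 < e → max 0 c < min a d →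
    R.carrier = {z : ℂ | (0 < z.re ∧ z.re < a ∧ 0 < z.im ∧ z.im < b) ∨
      (c < z.re ∧ z.re < d ∧ b < z.im ∧ z.im < b + e) ∨
      (max 0 c < z.re ∧ z.re < min a d ∧ z.im = b)} →
    Set.range R.pt = {(0 : ℂ), (a : ℂ), (d : ℂ) + ((b + e : ℝ) : ℂ) * Complex.I,
      (c : ℂ) + ((b + e : ℝ) : ℂ) * Complex.I} →
    ∃ L : ℝ, Tendsto (polygonWordAmplitude R) (𝓝[>] 0) (𝓝 L)

/-- Alias of the statement of `stub_oneStepModulusLaw`, keyed by the stub name. -/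
abbrev stub_oneStepModulusLaw : Prop :=
  ∃ G : ℝ → ℝ, ∀ (R : ConformalRectangle) (a b c d e : ℝ), 0 < b → 0 < e → max 0 c < min a d →
    R.carrier = {z : ℂ | (0 < z.re ∧ z.re < a ∧ 0 < z.im ∧ z.im < b) ∨
      (c < z.re ∧ z.re < d ∧ b < z.im ∧ z.im < b + e) ∨
      (max 0 c < z.re ∧ z.re < min a d ∧ z.im = b)} →
    Set.range R.pt = {(0 : ℂ), (a : ℂ), (d : ℂ) + ((b + e : ℝ) : ℂ) * Complex.I,
      (c : ℂ) + ((b + e : ℝ) : ℂ) * Complex.I} →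
    ∀ (φ : ConformalEquiv upperHalfPlaneSet R.carrier) (x : Fin 4 → ℝ), R.IsUniformizing φ x →
      ∀ L : ℝ, Tendsto (polygonWordAmplitude R) (𝓝[>] 0) (𝓝 L) → L = G (crossRatio x)

end Registered

/-- Consistency: each alias IS its stub (definitionally) — the stubs inhabit the aliases. -/
theorem registered_of_stubs :
    Registered.stub_rectangleData ∧ Registered.stub_oneStepWordExactness ∧
      Registered.stub_oneStepWordLimit ∧ Registered.stub_oneStepModulusLaw :=
  ⟨stub_rectangleData, stub_oneStepWordExactness, stub_oneStepWordLimit, stub_oneStepModulusLaw⟩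

/-! ## The composition: the four stubs imply the crux BY NAME -/

/-- **`CardyOneStep` from the stubs.** For a one-step polygon `R` with uniformizing datum `(φ, x)`:
realise `η = crossRatio x ∈ (0,1)` by a corner-marked rectangle `R₀` with datum `(φ₀, x₀)`; read
`R₀` both as a `CardyRectangle` instance (Cardy's value) and as a degenerate one-step polygon
(exactness, existence of the word limit, modulus law), so that uniqueness of limits along `𝓝[>] 0`
pins `G η = cardyFunction η`; then the word limit of `R` is `G η = cardyFunction η` and exactness
carries it back to `bondDomainCrossingProb R`. -/
theorem CardyOneStep_of (hRect : Registered.stub_rectangleData)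
    (hExact : Registered.stub_oneStepWordExactness) (hLim : Registered.stub_oneStepWordLimit)
    (hLaw : Registered.stub_oneStepModulusLaw) : CardyOneStep := by
  obtain ⟨G, hG⟩ := hLaw
  intro R a b c d e hb he hcd hcar hpt φ x hφx
  -- the modulus of `R`
  have hη : crossRatio x ∈ Ioo (0:ℝ) 1 := ConformalRectangle.crossRatio_mem_Ioo_of_isUniformizing hφx
  -- a corner-marked rectangle `R₀` with the same modulus
  obtain ⟨R₀, w, h, φ₀, x₀, hw, hh, hcar₀, hpt₀, hφx₀, hx₀⟩ := exists_rect_datum_of_mem_Ioo hη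
  have hh2 : (0:ℝ) < h / 2 := half_pos hh
  have hseam : max 0 (0:ℝ) < min w w := by rwa [max_self, min_self]
  -- Cardy on `R₀` (words of length one)
  have h1 : Tendsto (bondDomainCrossingProb R₀) (𝓝[>] 0) (𝓝 (cardyFunction (crossRatio x₀))) :=
    hRect R₀ w h hw hh (rect_carrier_setOf hcar₀) (rect_range_pt hpt₀) φ₀ x₀ hφx₀
  -- `R₀` as a degenerate one-step polygon: exactness, hence its word amplitude has Cardy's limit
  have h2 : polygonWordAmplitude R₀ =ᶠ[𝓝[>] 0] bondDomainCrossingProb R₀ :=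
    eventually_nhdsWithin_of_forall fun δ hδ =>
      (hExact R₀ w (h / 2) 0 w (h / 2) hh2 hh2 hseam (rect_carrier_oneStep hh hcar₀) δ hδ).symm
  have h3 : Tendsto (polygonWordAmplitude R₀) (𝓝[>] 0) (𝓝 (cardyFunction (crossRatio x₀))) :=
    h1.congr' h2.symm
  -- the modulus law on `R₀` pins `G` at `η`
  have hGη : cardyFunction (crossRatio x₀) = G (crossRatio x₀) :=
    hG R₀ w (h / 2) 0 w (h / 2) hh2 hh2 hseam (rect_carrier_oneStep hh hcar₀)
      (rect_range_pt_oneStep hpt₀) φ₀ x₀ hφx₀ _ h3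
  -- the word limit of `R` exists and is `G η`
  obtain ⟨L, hL⟩ := hLim R a b c d e hb he hcd hcar hpt
  have hLG : L = G (crossRatio x) := hG R a b c d e hb he hcd hcar hpt φ x hφx L hL
  have hLc : L = cardyFunction (crossRatio x) := by rw [hLG, ← hx₀, ← hGη]
  -- back to the G02 crossing probability of `R` by exactness
  have h4 : polygonWordAmplitude R =ᶠ[𝓝[>] 0] bondDomainCrossingProb R :=
    eventually_nhdsWithin_of_forall fun δ hδ => (hExact R a b c d e hb he hcd hcar δ hδ).symm
  rw [← hLc]
  exact hL.congr' h4

end Summit.CriticalPhenomena.CardyFormulaZ2.Cruxes.CardyOneStep.Birth
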